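import Literature.AlgebraicGeometry.Frobenioids.PerfectionFunctoriality
import Literature.AlgebraicGeometry.Frobenioids.PerfectionEquivalence
import Literature.AlgebraicGeometry.Frobenioids.BaseCategoryTheoreticity
import HarnessLib

/-!
# Frobenioids I, Theorem 3.4 (iii), the perfection square: `1`-uniqueness of `Ψ^pf` when `C₁` is of
# perfect type (PROOFS)

Mochizuki, *The geometry of Frobenioids I: the general theory*, Kyushu J. Math. **62** (2008), Theorem
3.4 (iii) p. 62 l. 42 – p. 63 l. 2 [cite: MochizukiFrdI2008, Thm. 3.4 (iii) p.62]: "there exists a 1-unique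
functor `Ψ^pf : C₁^pf → C₂^pf` that fits into a 1-commutative diagram". The cell types `1`-uniqueness as: every
functor `B′ : C₁^pf → C₂^pf` making the square with `C_i → C_i^pf` `1`-commute is isomorphic to `Ψ^pf` (third
conjunct of `OneUniqueSquare`, slot `FrdI.Thm34Sub.L01p_PfSquareUnique` of seat abc-iut-L1-d8). This file proves
that conjunct WHEN `C₁` IS OF PERFECT TYPE: then `C₁ → C₁^pf` is an equivalence (`Perfection.toPf_isEquivalence`,
`PerfectionEquivalence.lean`), and isomorphisms `toPf ⋙ B′ ≅ toPf ⋙ Ψ^pf` descend along it. (For a general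
Frobenioid `C₁ → C₁^pf` is not essentially surjective — `(A, n)` need not be in the essential image — and the
conjunct is not available from the square alone; recorded as a typed-shape question with the slot holder.)

* `Perfection.iso_of_toPf_comp_iso` — cancelling the equivalence `toPf hF₁` on the left;
* `Perfection.map_unique_of_isOfPerfectType` — any `B′` with `Ψ ⋙ toPf ≅ toPf ⋙ B′` is `≅ Perfection.map hΨ`;
* `Perfection.oneUniqueSquare_map_of_isOfPerfectType` — the full `OneUniqueSquare` for an equivalence `Ψ`.
-/

namespace Literature.AlgebraicGeometry.Frobenioids

namespace PreFrobenioid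

namespace Perfection

open CategoryTheory Opposite

universe w₁ v₁ v₁' u₁ u₁' w₂ v₂ v₂' u₂ u₂'

variable {D₁ : Type u₁} [Category.{v₁} D₁] {Φ₁ : D₁ᵒᵖ ⥤ CommMonCat.{w₁}}
  {C₁ : Type u₁'} [Category.{v₁'} C₁] {F₁ : C₁ ⥤ ElemFrobenioid Φ₁} {hF₁ : IsFrobenioid F₁}
  {D₂ : Type u₂} [Category.{v₂} D₂] {Φ₂ : D₂ᵒᵖ ⥤ CommMonCat.{w₂}}
  {C₂ : Type u₂'} [Category.{v₂'} C₂] {F₂ : C₂ ⥤ ElemFrobenioid Φ₂} {hF₂ : IsFrobenioid F₂}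

/-- For `C₁` of perfect type, natural isomorphisms between functors out of `C₁^pf` may be checked after
precomposition with the equivalence `C₁ → C₁^pf`. [cite: MochizukiFrdI2008, Prop. 3.2 (iii) p.59] -/
theorem iso_of_toPf_comp_iso (hP₁ : IsOfPerfectType F₁) {E : Type*} [Category E]
    {B B' : Perfection hF₁ ⥤ E} (e : toPf hF₁ ⋙ B' ≅ toPf hF₁ ⋙ B) : Nonempty (B' ≅ B) := by
  haveI := toPf_isEquivalence hF₁ hP₁
  exact ⟨((toPf hF₁).asEquivalence.congrLeft (E := E)).fullyFaithfulInverse.preimageIso e⟩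

variable {G : C₁ ⥤ C₂} (hG : IsFrobeniusCompatible F₁ F₂ G)
include hG

/-- **`1`-uniqueness of `Ψ^pf` for `C₁` of perfect type**: any `B′ : C₁^pf → C₂^pf` making the square
`1`-commute (`Ψ ⋙ toPf ≅ toPf ⋙ B′`) is isomorphic to `Perfection.map hΨ`. [cite: MochizukiFrdI2008, Thm. 3.4 (iii) p.62] -/
theorem map_unique_of_isOfPerfectType (hP₁ : IsOfPerfectType F₁) (B' : Perfection hF₁ ⥤ Perfection hF₂)
    (h : OneCommutes G (toPf hF₂) (toPf hF₁) B') : Nonempty (B' ≅ map (hF₁ := hF₁) (hF₂ := hF₂) hG) := by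
  obtain ⟨i⟩ := h
  exact iso_of_toPf_comp_iso hP₁ (i.symm ≪≫ (toPfCompMapIso hG).symm)

omit hG in
/-- **The complete `OneUniqueSquare` for the perfection square when `C₁` is of perfect type** and `Ψ` is an
equivalence compatible with arrows of Frobenius type: `Ψ^pf` is an equivalence, the square `1`-commutes, and
`Ψ^pf` is `1`-unique. [cite: MochizukiFrdI2008, Thm. 3.4 (iii) p.62] -/
theorem oneUniqueSquare_map_of_isOfPerfectType (hP₁ : IsOfPerfectType F₁) (Ψ : C₁ ≌ C₂)
    (hΨ : IsFrobeniusCompatible F₁ F₂ Ψ.functor) :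
    PreFrobenioidData.OneUniqueSquare Ψ.functor (toPf hF₁) (toPf hF₂) (map (hF₁ := hF₁) (hF₂ := hF₂) hΨ) :=
  ⟨map_isEquivalence Ψ hΨ, ⟨(toPfCompMapIso hΨ).symm⟩, fun B' hB' => map_unique_of_isOfPerfectType hΨ hP₁ B' hB'⟩

end Perfection

end PreFrobenioid

end Literature.AlgebraicGeometry.Frobenioids
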